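import Summits.AtomisticToContinuum.HydrodynamicLimit.Theorems.InformationPercolationEngineChaosClosesEulerPressureValueB
import Summits.AtomisticToContinuum.HydrodynamicLimit.Theorems.InformationPercolationEngineChaosClosesEulerStressIsotropyC
import HarnessLib

/-!
# Collisional pressure value in band (crux `ChaosClosesEuler`, stmt-AtomisticToContinuum-15141, line `Sketch`,
# stub `stub_pressureValueOfEnskog`) — helper F: velocity-truncation defect and the deviatoric split

WHAT. For ONE configuration `w`, one centre `x`, `0 < r`, `0 < L`, with the truncated single-law moments
`A₀ = M(ψ_L)`, `A₁ₘ = M(vₘψ_L)`, `A₂ₘₙ = M(vₘvₙψ_L)` (`M = MpsiC r w x`, `ψ_L = speedCutoff L ‖·‖`) and the truncated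
Gram form `Qₘₙ = A₀A₂ₘₙ − A₁ₘA₁ₙ` of helper B:

* `abs_Q_sub_le` — THE TRUNCATION DEFECT: `|Qₘₙ − (ρ_r M_{mn} − mₘmₙ)| ≤ 10 ρ_r · M(sqTail L)` (the cutoff only removes
  particles of speed `> L`; Cauchy–Schwarz for the cross term), so that it is paid by the quadratic speed tail with ONE
  factor `ρ_r` to spare (absorbed by `σ³ρ_r ≤ η₀` in band);
* `rhoC_mul_Mmom_sub_eq` — `ρ_r M_{kl} − mₖmₗ = ρ_r Σ^dev_{kl} + ρ_r²θ_r δ_{kl}` (definition of the traceless stress);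
* `pairFunctional_markT_sub_eq` — THE DEVIATORIC SPLIT of the Enskog pair functional of the truncated stress mark:
  `B_r(𝒯[L,k,l]) − (4π/3)ρ_r²θ_r δ_kl = (4π/15)(δ_kl tr D + 2 D_kl) + (8π/15) ρ_r Σ^dev_{kl}`, `D = Q − (ρ_r M − m⊗m)`;
* `abs_weighted_sum_sub_le` — contracted with a coefficient `a` (`|a_kl| ≤ A`) and a scalar weight `W`:
  `|Σ a_kl W (B_r(𝒯) − (4π/3)ρ²θδ) − (8π/15)(Wρ_r) Σ ã_kl P_kl| ≤ 120π A |W| ρ_r M(sqTail L)` with the TRACELESS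
  part `ã = a − (tr a/3)𝟙` and the central second moments `P_kl = M(v_kv_l) − mₖmₗ/ρ_r` — the integrand of
  `WeakStressIsotropyInBand`.

References: S. Chapman, T. G. Cowling (1970) §16.4 (Enskog's collisional transfer at a local Maxwellian).
-/

noncomputable section

namespace Summit.AtomisticToContinuum.HydrodynamicLimit.Theorems.ChaosClosesEulerPressureValue

open scoped BigOperators Topology Classical MeasureTheory ENNReal InnerProductSpace
open Filter Set MeasureTheory
open Literature.MathematicalPhysics.KineticTheory
open Literature.Analysis.FluidPDE
open Summit.AtomisticToContinuum.HydrodynamicLimit.Theorems.LocalSecondLawNegative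
open Summit.AtomisticToContinuum.HydrodynamicLimit.Theorems.LocalSecondLawLedger
open Summit.AtomisticToContinuum.HydrodynamicLimit.Theorems.LocalSecondLawLedger.L
  (Mmom rhoC_eq_sum momC_apply_eq_sum momC_eq_sum kinC_eq_trace norm_sq_eq_sum)

/-- The truncated stress mark `𝒯[L,k,l]` (local notation for an explicit lambda). -/
local notation3 "𝒯[" L ", " k ", " l "]" => fun q : V3 × V3 × V3 =>
  min |⟪q.2.1 - q.2.2, q.1⟫_ℝ| (4 * L) * (speedCutoff L ‖q.2.1‖ * speedCutoff L ‖q.2.2‖) * (clip1 (q.1 k) * clip1 (q.1 l))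

/-- The dominating mark `ℬ[L]` (local notation for an explicit lambda). -/
local notation3 "ℬ[" L "]" => fun q : V3 × V3 × V3 => 4 * L * (speedCutoff L ‖q.2.1‖ * speedCutoff L ‖q.2.2‖)

section Defect

open Summit.AtomisticToContinuum.HydrodynamicLimit.Theorems.ChaosClosesEulerStressIsotropy

variable {N : ℕ}

/-! ## §1 The truncated moments as `ψ`-moments -/

/-- The pair functional of the truncated stress mark through `ψ`-moments:
`B_r(𝒯[L,k,l]) = (4π/15)(δ_kl Σₘ Qₘₘ + 2 Q_kl)`, `Qₘₙ = M(ψ_L) M(vₘvₙψ_L) − M(vₘψ_L) M(vₙψ_L)`. [folklore] -/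
theorem pairFunctional_markT_eq_MpsiC {L : ℝ} (hL : 0 < L) (r : ℝ) (w : Phase N) (x : T3) (k l : Fin 3) :
    pairFunctional r 𝒯[L, k, l] w x = 4 * Real.pi / 15 *
      ((if k = l then 1 else 0) * ∑ m : Fin 3,
          (MpsiC r w x (fun v => speedCutoff L ‖v‖) * MpsiC r w x (fun v => v m * v m * speedCutoff L ‖v‖) -
            MpsiC r w x (fun v => v m * speedCutoff L ‖v‖) * MpsiC r w x (fun v => v m * speedCutoff L ‖v‖)) +
        2 * (MpsiC r w x (fun v => speedCutoff L ‖v‖) * MpsiC r w x (fun v => v k * v l * speedCutoff L ‖v‖) -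
            MpsiC r w x (fun v => v k * speedCutoff L ‖v‖) * MpsiC r w x (fun v => v l * speedCutoff L ‖v‖))) := by
  have h0 : MpsiC r w x (fun v => speedCutoff L ‖v‖) =
      ((N + 1 : ℕ) : ℝ)⁻¹ * ∑ i, cone r (w i).1 x * speedCutoff L ‖(w i).2‖ := by rw [MpsiC_eq_sum]
  have h1 : ∀ m : Fin 3, MpsiC r w x (fun v => v m * speedCutoff L ‖v‖) =
      ((N + 1 : ℕ) : ℝ)⁻¹ * ∑ i, cone r (w i).1 x * speedCutoff L ‖(w i).2‖ * (w i).2 m := fun m => by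
    rw [MpsiC_eq_sum]; congr 1; exact Finset.sum_congr rfl fun i _ => by ring
  have h2 : ∀ m n : Fin 3, MpsiC r w x (fun v => v m * v n * speedCutoff L ‖v‖) =
      ((N + 1 : ℕ) : ℝ)⁻¹ * ∑ i, cone r (w i).1 x * speedCutoff L ‖(w i).2‖ * ((w i).2 m * (w i).2 n) := fun m n => by
    rw [MpsiC_eq_sum]; congr 1; exact Finset.sum_congr rfl fun i _ => by ring
  rw [pairFunctional_markT_eq hL]
  simp only [h0, h1, h2]
  have e : ∑ m : Fin 3, ((((N + 1 : ℕ) : ℝ)⁻¹ * ∑ i, cone r (w i).1 x * speedCutoff L ‖(w i).2‖) *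
        (((N + 1 : ℕ) : ℝ)⁻¹ * ∑ i, cone r (w i).1 x * speedCutoff L ‖(w i).2‖ * ((w i).2 m * (w i).2 m)) -
      (((N + 1 : ℕ) : ℝ)⁻¹ * ∑ i, cone r (w i).1 x * speedCutoff L ‖(w i).2‖ * (w i).2 m) *
        (((N + 1 : ℕ) : ℝ)⁻¹ * ∑ i, cone r (w i).1 x * speedCutoff L ‖(w i).2‖ * (w i).2 m)) =
      ((N + 1 : ℕ) : ℝ)⁻¹ * ((N + 1 : ℕ) : ℝ)⁻¹ * ∑ m : Fin 3,
        ((∑ i, cone r (w i).1 x * speedCutoff L ‖(w i).2‖) *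
            (∑ i, cone r (w i).1 x * speedCutoff L ‖(w i).2‖ * ((w i).2 m * (w i).2 m)) -
          (∑ i, cone r (w i).1 x * speedCutoff L ‖(w i).2‖ * (w i).2 m) *
            (∑ i, cone r (w i).1 x * speedCutoff L ‖(w i).2‖ * (w i).2 m)) := by
    conv_rhs => rw [Finset.mul_sum]
    exact Finset.sum_congr rfl fun m _ => by ring
  rw [e]
  ring

/-! ## §2 The truncation defect -/

/-- **The truncation defect of the Gram form**: with `TL = MpsiC (sqTail L)`,
`|Qₘₙ − (ρ_r M_{mn} − mₘmₙ)| ≤ 10 ρ_r TL` (`0 < r`, `0 < L`). [folklore] -/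
theorem abs_Q_sub_le {L r : ℝ} (hL : 0 < L) (hr : 0 < r) (w : Phase N) (x : T3) (m n : Fin 3) :
    |(MpsiC r w x (fun v => speedCutoff L ‖v‖) * MpsiC r w x (fun v => v m * v n * speedCutoff L ‖v‖) -
        MpsiC r w x (fun v => v m * speedCutoff L ‖v‖) * MpsiC r w x (fun v => v n * speedCutoff L ‖v‖)) -
      (rhoC r w x * Mmom r w x m n - momC r w x m * momC r w x n)| ≤
      10 * (rhoC r w x * MpsiC r w x (sqTail L)) := by
  -- names
  set n1 : ℝ := ((N + 1 : ℕ) : ℝ)⁻¹ with hn1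
  have hn1' : 0 ≤ n1 := by positivity
  set b : Fin (N + 1) → ℝ := fun i => cone r (w i).1 x with hb
  set vv : Fin (N + 1) → V3 := fun i => (w i).2 with hvv
  set ps : Fin (N + 1) → ℝ := fun i => speedCutoff L ‖vv i‖ with hps
  set d : Fin (N + 1) → ℝ := fun i => b i * (1 - ps i) with hd
  have hdi : ∀ i, d i = b i * (1 - ps i) := fun i => by rw [hd]
  have hpsi : ∀ i, ps i = speedCutoff L ‖vv i‖ := fun i => by rw [hps]
  have hb0 : ∀ i, 0 ≤ b i := fun i => cone_nonneg hr _ _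
  have hps01 : ∀ i, 0 ≤ ps i ∧ ps i ≤ 1 := fun i => by rw [hpsi]; exact speedCutoff_mem_Icc L _
  have hd0 : ∀ i, 0 ≤ d i := fun i => by rw [hdi]; exact mul_nonneg (hb0 i) (by linarith [(hps01 i).2])
  -- the players as sums
  set A0 := MpsiC r w x (fun v => speedCutoff L ‖v‖) with hA0
  set A1 : Fin 3 → ℝ := fun m => MpsiC r w x (fun v => v m * speedCutoff L ‖v‖) with hA1
  set A2 : Fin 3 → Fin 3 → ℝ := fun m n => MpsiC r w x (fun v => v m * v n * speedCutoff L ‖v‖) with hA2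
  set ρ := rhoC r w x with hρ
  set TL := MpsiC r w x (sqTail L) with hTL
  have eA0 : A0 = n1 * ∑ i, b i * ps i := by rw [hA0, MpsiC_eq_sum]
  have eA1 : ∀ m, A1 m = n1 * ∑ i, b i * ps i * vv i m := fun m => by
    rw [hA1]; dsimp only; rw [MpsiC_eq_sum]; congr 1; exact Finset.sum_congr rfl fun i _ => by ring
  have eA2 : ∀ m n, A2 m n = n1 * ∑ i, b i * ps i * (vv i m * vv i n) := fun m n => by
    rw [hA2]; dsimp only; rw [MpsiC_eq_sum]; congr 1; exact Finset.sum_congr rfl fun i _ => by ring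
  have eρ : ρ = n1 * ∑ i, b i := by rw [hρ, rhoC_eq_sum]
  have em : ∀ m, momC r w x m = n1 * ∑ i, b i * vv i m := fun m => by rw [momC_apply_eq_sum]
  have eM : ∀ m n, Mmom r w x m n = n1 * ∑ i, b i * (vv i m * vv i n) := fun m n => rfl
  have eTL : TL = n1 * ∑ i, b i * sqTail L (vv i) := by rw [hTL, MpsiC_eq_sum]
  -- elementary pointwise facts
  have hcoord : ∀ (m : Fin 3) (v : V3), |v m| ≤ ‖v‖ := fun m v => by
    have := PiLp.norm_apply_le v m; rwa [Real.norm_eq_abs] at this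
  have hdtail : ∀ i, d i * ‖vv i‖ ^ 2 ≤ b i * sqTail L (vv i) := by
    intro i
    rw [hdi, mul_assoc, mul_comm (1 - ps i)]
    exact mul_le_mul_of_nonneg_left (norm_sq_mul_le_sqTail (by linarith [(hps01 i).1])
      (fun h => by rw [hpsi, speedCutoff_eq_one hL h, sub_self])) (hb0 i)
  have hdtail' : ∀ i, d i ≤ b i * sqTail L (vv i) / L ^ 2 := by
    intro i
    rw [le_div_iff₀ (by positivity)]
    by_cases h0 : 1 - ps i = 0
    · have : d i = 0 := by rw [hdi, h0, mul_zero]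
      rw [this, zero_mul]; exact mul_nonneg (hb0 i) (sqTail_nonneg L _)
    · have hgt : L < ‖vv i‖ := by
        by_contra hle
        exact h0 (by rw [hpsi, speedCutoff_eq_one hL (not_lt.1 hle), sub_self])
      calc d i * L ^ 2 ≤ d i * ‖vv i‖ ^ 2 :=
            mul_le_mul_of_nonneg_left (pow_le_pow_left₀ hL.le hgt.le 2) (hd0 i)
        _ ≤ b i * sqTail L (vv i) := hdtail i
  have hdtailL : ∀ i, d i * ‖vv i‖ ≤ b i * sqTail L (vv i) / L := by
    intro i
    rw [le_div_iff₀ hL]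
    by_cases h0 : 1 - ps i = 0
    · have : d i = 0 := by rw [hdi, h0, mul_zero]
      rw [this, zero_mul, zero_mul]; exact mul_nonneg (hb0 i) (sqTail_nonneg L _)
    · have hgt : L < ‖vv i‖ := by
        by_contra hle
        exact h0 (by rw [hpsi, speedCutoff_eq_one hL (not_lt.1 hle), sub_self])
      calc d i * ‖vv i‖ * L ≤ d i * ‖vv i‖ * ‖vv i‖ :=
            mul_le_mul_of_nonneg_left hgt.le (mul_nonneg (hd0 i) (norm_nonneg _))
        _ = d i * ‖vv i‖ ^ 2 := by ring
        _ ≤ b i * sqTail L (vv i) := hdtail i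
  have hcv : ∀ i, b i * ps i * ‖vv i‖ ≤ 2 * L * b i := by
    intro i
    by_cases h0 : ps i = 0
    · rw [h0, mul_zero, zero_mul]; exact mul_nonneg (by linarith) (hb0 i)
    · have hv : ‖vv i‖ < 2 * L := norm_lt_of_speedCutoff_ne_zero hL (by rwa [hpsi] at h0)
      calc b i * ps i * ‖vv i‖ ≤ b i * 1 * (2 * L) :=
            mul_le_mul (mul_le_mul_of_nonneg_left (hps01 i).2 (hb0 i)) hv.le (norm_nonneg _)
              (mul_nonneg (hb0 i) zero_le_one)
        _ = 2 * L * b i := by ring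
  have hcv2 : ∀ i, b i * ps i * ‖vv i‖ ^ 2 ≤ 4 * L ^ 2 * b i := by
    intro i
    by_cases h0 : ps i = 0
    · rw [h0, mul_zero, zero_mul]; exact mul_nonneg (by positivity) (hb0 i)
    · have hv : ‖vv i‖ < 2 * L := norm_lt_of_speedCutoff_ne_zero hL (by rwa [hpsi] at h0)
      have hv2 : ‖vv i‖ ^ 2 ≤ (2 * L) ^ 2 := pow_le_pow_left₀ (norm_nonneg _) hv.le 2
      calc b i * ps i * ‖vv i‖ ^ 2 ≤ b i * 1 * (2 * L) ^ 2 :=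
            mul_le_mul (mul_le_mul_of_nonneg_left (hps01 i).2 (hb0 i)) hv2 (sq_nonneg _)
              (mul_nonneg (hb0 i) zero_le_one)
        _ = 4 * L ^ 2 * b i := by ring
  -- the four differences
  have hρpos : 0 ≤ ρ := by rw [eρ]; exact mul_nonneg hn1' (Finset.sum_nonneg fun i _ => hb0 i)
  have hTL0 : 0 ≤ TL := by rw [eTL]; exact mul_nonneg hn1' (Finset.sum_nonneg fun i _ => mul_nonneg (hb0 i) (sqTail_nonneg L _))
  -- (1) `|A0 − ρ| ≤ TL / L²`
  have d1 : |A0 - ρ| ≤ TL / L ^ 2 := by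
    have e : A0 - ρ = -(n1 * ∑ i, d i) := by
      rw [eA0, eρ, ← mul_sub, ← Finset.sum_sub_distrib, ← mul_neg, ← Finset.sum_neg_distrib]
      congr 1; exact Finset.sum_congr rfl fun i _ => by rw [hdi]; ring
    rw [e, abs_neg, abs_of_nonneg (mul_nonneg hn1' (Finset.sum_nonneg fun i _ => hd0 i)), eTL, mul_div_assoc,
      Finset.sum_div]
    exact mul_le_mul_of_nonneg_left (Finset.sum_le_sum fun i _ => hdtail' i) hn1'
  -- (2) `|A2 − M| ≤ TL`
  have d2 : |A2 m n - Mmom r w x m n| ≤ TL := by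
    have e : A2 m n - Mmom r w x m n = -(n1 * ∑ i, d i * (vv i m * vv i n)) := by
      rw [eA2, eM, ← mul_sub, ← Finset.sum_sub_distrib, ← mul_neg, ← Finset.sum_neg_distrib]
      congr 1; exact Finset.sum_congr rfl fun i _ => by rw [hdi]; ring
    rw [e, abs_neg, abs_mul, abs_of_nonneg hn1', eTL]
    refine mul_le_mul_of_nonneg_left ((Finset.abs_sum_le_sum_abs _ _).trans (Finset.sum_le_sum fun i _ => ?_)) hn1'
    rw [abs_mul, abs_of_nonneg (hd0 i)]
    calc d i * |vv i m * vv i n| ≤ d i * ‖vv i‖ ^ 2 := mul_le_mul_of_nonneg_left (by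
          rw [abs_mul, sq]; exact mul_le_mul (hcoord m _) (hcoord n _) (abs_nonneg _) (norm_nonneg _)) (hd0 i)
      _ ≤ b i * sqTail L (vv i) := hdtail i
  -- (3) `|A1 − m| ≤ J := n1 Σ dᵢ‖vᵢ‖`, `J ≤ TL / L`, `J² ≤ ρ TL`
  set J : ℝ := n1 * ∑ i, d i * ‖vv i‖ with hJ
  have hJ0 : 0 ≤ J := mul_nonneg hn1' (Finset.sum_nonneg fun i _ => mul_nonneg (hd0 i) (norm_nonneg _))
  have d3 : ∀ m', |A1 m' - momC r w x m'| ≤ J := by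
    intro m'
    have e : A1 m' - momC r w x m' = -(n1 * ∑ i, d i * vv i m') := by
      rw [eA1, em, ← mul_sub, ← Finset.sum_sub_distrib, ← mul_neg, ← Finset.sum_neg_distrib]
      congr 1; exact Finset.sum_congr rfl fun i _ => by rw [hdi]; ring
    rw [e, abs_neg, abs_mul, abs_of_nonneg hn1']
    refine mul_le_mul_of_nonneg_left ((Finset.abs_sum_le_sum_abs _ _).trans (Finset.sum_le_sum fun i _ => ?_)) hn1'
    rw [abs_mul, abs_of_nonneg (hd0 i)]
    exact mul_le_mul_of_nonneg_left (hcoord m' _) (hd0 i)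
  have hJL : J ≤ TL / L := by
    rw [hJ, eTL, mul_div_assoc, Finset.sum_div]
    exact mul_le_mul_of_nonneg_left (Finset.sum_le_sum fun i _ => hdtailL i) hn1'
  have hJ2 : J * J ≤ ρ * TL := by
    have hcs := Finset.sum_sq_le_sum_mul_sum_of_sq_le_mul Finset.univ (r := fun i => d i * ‖vv i‖) (f := d)
      (g := fun i => d i * ‖vv i‖ ^ 2) (fun i _ => hd0 i) (fun i _ => mul_nonneg (hd0 i) (sq_nonneg _))
      (fun i _ => by nlinarith [hd0 i])
    have h1 : ∑ i, d i ≤ ∑ i, b i := Finset.sum_le_sum fun i _ => by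
      rw [hdi]; nlinarith [hb0 i, (hps01 i).1]
    have h2 : ∑ i, d i * ‖vv i‖ ^ 2 ≤ ∑ i, b i * sqTail L (vv i) := Finset.sum_le_sum fun i _ => hdtail i
    have hd' : 0 ≤ ∑ i, d i := Finset.sum_nonneg fun i _ => hd0 i
    have hg' : 0 ≤ ∑ i, d i * ‖vv i‖ ^ 2 := Finset.sum_nonneg fun i _ => mul_nonneg (hd0 i) (sq_nonneg _)
    rw [hJ, eρ, eTL]
    calc n1 * (∑ i, d i * ‖vv i‖) * (n1 * ∑ i, d i * ‖vv i‖) = n1 * n1 * (∑ i, d i * ‖vv i‖) ^ 2 := by ring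
      _ ≤ n1 * n1 * ((∑ i, d i) * ∑ i, d i * ‖vv i‖ ^ 2) := mul_le_mul_of_nonneg_left hcs (mul_nonneg hn1' hn1')
      _ ≤ n1 * n1 * ((∑ i, b i) * ∑ i, b i * sqTail L (vv i)) :=
          mul_le_mul_of_nonneg_left (mul_le_mul h1 h2 hg' (hd'.trans h1)) (mul_nonneg hn1' hn1')
      _ = n1 * (∑ i, b i) * (n1 * ∑ i, b i * sqTail L (vv i)) := by ring
  -- (4) a-priori bounds of the truncated moments
  have d4 : ∀ m', |A1 m'| ≤ 2 * L * ρ := by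
    intro m'
    rw [eA1, eρ, abs_mul, abs_of_nonneg hn1', mul_left_comm, Finset.mul_sum]
    refine mul_le_mul_of_nonneg_left ((Finset.abs_sum_le_sum_abs _ _).trans (Finset.sum_le_sum fun i _ => ?_)) hn1'
    rw [abs_mul, abs_of_nonneg (mul_nonneg (hb0 i) (hps01 i).1)]
    exact (mul_le_mul_of_nonneg_left (hcoord m' _) (mul_nonneg (hb0 i) (hps01 i).1)).trans (hcv i)
  have d5 : |A2 m n| ≤ 4 * L ^ 2 * ρ := by
    rw [eA2, eρ, abs_mul, abs_of_nonneg hn1', mul_left_comm, Finset.mul_sum]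
    refine mul_le_mul_of_nonneg_left ((Finset.abs_sum_le_sum_abs _ _).trans (Finset.sum_le_sum fun i _ => ?_)) hn1'
    rw [abs_mul, abs_of_nonneg (mul_nonneg (hb0 i) (hps01 i).1)]
    refine (mul_le_mul_of_nonneg_left ?_ (mul_nonneg (hb0 i) (hps01 i).1)).trans (hcv2 i)
    rw [abs_mul, sq]; exact mul_le_mul (hcoord m _) (hcoord n _) (abs_nonneg _) (norm_nonneg _)
  -- assembly
  have hsplit : (A0 * A2 m n - A1 m * A1 n) - (ρ * Mmom r w x m n - momC r w x m * momC r w x n) =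
      (A0 - ρ) * A2 m n + ρ * (A2 m n - Mmom r w x m n) -
        (A1 m * (A1 n - momC r w x n) + (A1 m - momC r w x m) * A1 n -
          (A1 m - momC r w x m) * (A1 n - momC r w x n)) := by ring
  rw [hsplit]
  have t1 : |(A0 - ρ) * A2 m n| ≤ 4 * (ρ * TL) := by
    rw [abs_mul]
    calc |A0 - ρ| * |A2 m n| ≤ TL / L ^ 2 * (4 * L ^ 2 * ρ) := mul_le_mul d1 d5 (abs_nonneg _) (by positivity)
      _ = 4 * (ρ * TL) := by field_simp
  have t2 : |ρ * (A2 m n - Mmom r w x m n)| ≤ ρ * TL := by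
    rw [abs_mul, abs_of_nonneg hρpos]; exact mul_le_mul_of_nonneg_left d2 hρpos
  have t3 : |A1 m * (A1 n - momC r w x n)| ≤ 2 * (ρ * TL) := by
    rw [abs_mul]
    calc |A1 m| * |A1 n - momC r w x n| ≤ 2 * L * ρ * (TL / L) :=
          mul_le_mul (d4 m) ((d3 n).trans hJL) (abs_nonneg _) (by positivity)
      _ = 2 * (ρ * TL) := by field_simp
  have t4 : |(A1 m - momC r w x m) * A1 n| ≤ 2 * (ρ * TL) := by
    rw [abs_mul]
    calc |A1 m - momC r w x m| * |A1 n| ≤ TL / L * (2 * L * ρ) :=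
          mul_le_mul ((d3 m).trans hJL) (d4 n) (abs_nonneg _) (by positivity)
      _ = 2 * (ρ * TL) := by field_simp
  have t5 : |(A1 m - momC r w x m) * (A1 n - momC r w x n)| ≤ ρ * TL := by
    rw [abs_mul]
    exact (mul_le_mul (d3 m) (d3 n) (abs_nonneg _) hJ0).trans hJ2
  have u1 := abs_add_le ((A0 - ρ) * A2 m n) (ρ * (A2 m n - Mmom r w x m n))
  have u2 : |A1 m * (A1 n - momC r w x n) + (A1 m - momC r w x m) * A1 n -
      (A1 m - momC r w x m) * (A1 n - momC r w x n)| ≤ 5 * (ρ * TL) := by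
    refine (abs_sub _ _).trans ?_
    have := abs_add_le (A1 m * (A1 n - momC r w x n)) ((A1 m - momC r w x m) * A1 n)
    linarith
  refine (abs_sub _ _).trans ?_
  linarith

/-! ## §3 The deviatoric split -/

/-- `ρ_r M_{kl} − mₖmₗ = ρ_r Σ^dev_{kl} + ρ_r²θ_r δ_{kl}` (both sides vanish on the empty cone). [folklore] -/
theorem rhoC_mul_Mmom_sub_eq {r : ℝ} (hr : 0 < r) (w : Phase N) (x : T3) (k l : Fin 3) :
    rhoC r w x * Mmom r w x k l - momC r w x k * momC r w x l =
      rhoC r w x * devC r w x k l + rhoC r w x ^ 2 * thetaC r w x * (if k = l then 1 else 0) := by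
  have h := ChaosClosesEulerReduction.Pm_eq_devC_add hr w x k l
  by_cases h0 : rhoC r w x = 0
  · rw [ChaosClosesEulerReduction.momC_eq_zero_of_rhoC hr h0, h0]; simp
  · have e : rhoC r w x * Mmom r w x k l - momC r w x k * momC r w x l =
        rhoC r w x * (Mmom r w x k l - momC r w x k * momC r w x l / rhoC r w x) := by field_simp
    rw [e, h]; ring

/-- **The deviatoric split of the Enskog pair functional of the truncated stress mark**:
`B_r(𝒯[L,k,l]) − (4π/3)ρ_r²θ_rδ_kl = (4π/15)(δ_kl Σₘ Dₘₘ + 2 D_kl) + (8π/15) ρ_r Σ^dev_{kl}`,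
`Dₘₙ = Qₘₙ − (ρ_r M_{mn} − mₘmₙ)`. [cite: ChapmanCowling1970, §16.4] -/
theorem pairFunctional_markT_sub_eq {L r : ℝ} (hL : 0 < L) (hr : 0 < r) (w : Phase N) (x : T3) (k l : Fin 3) :
    pairFunctional r 𝒯[L, k, l] w x - 4 * Real.pi / 3 * (rhoC r w x ^ 2 * thetaC r w x) * (if k = l then 1 else 0) =
      4 * Real.pi / 15 *
        ((if k = l then 1 else 0) * ∑ m : Fin 3,
            ((MpsiC r w x (fun v => speedCutoff L ‖v‖) * MpsiC r w x (fun v => v m * v m * speedCutoff L ‖v‖) -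
              MpsiC r w x (fun v => v m * speedCutoff L ‖v‖) * MpsiC r w x (fun v => v m * speedCutoff L ‖v‖)) -
              (rhoC r w x * Mmom r w x m m - momC r w x m * momC r w x m)) +
          2 * ((MpsiC r w x (fun v => speedCutoff L ‖v‖) * MpsiC r w x (fun v => v k * v l * speedCutoff L ‖v‖) -
              MpsiC r w x (fun v => v k * speedCutoff L ‖v‖) * MpsiC r w x (fun v => v l * speedCutoff L ‖v‖)) -
              (rhoC r w x * Mmom r w x k l - momC r w x k * momC r w x l))) +
      8 * Real.pi / 15 * (rhoC r w x * devC r w x k l) := by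
  have htr : ∑ m : Fin 3, (rhoC r w x * Mmom r w x m m - momC r w x m * momC r w x m) =
      3 * (rhoC r w x ^ 2 * thetaC r w x) := by
    simp_rw [rhoC_mul_Mmom_sub_eq hr]
    rw [Finset.sum_add_distrib, ← Finset.mul_sum, devC_trace hr w x, mul_zero, zero_add]
    simp only [Fin.sum_univ_three, if_true]; ring
  have key : ∑ m : Fin 3,
      ((MpsiC r w x (fun v => speedCutoff L ‖v‖) * MpsiC r w x (fun v => v m * v m * speedCutoff L ‖v‖) -
        MpsiC r w x (fun v => v m * speedCutoff L ‖v‖) * MpsiC r w x (fun v => v m * speedCutoff L ‖v‖)) -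
        (rhoC r w x * Mmom r w x m m - momC r w x m * momC r w x m)) =
      (∑ m : Fin 3,
        (MpsiC r w x (fun v => speedCutoff L ‖v‖) * MpsiC r w x (fun v => v m * v m * speedCutoff L ‖v‖) -
          MpsiC r w x (fun v => v m * speedCutoff L ‖v‖) * MpsiC r w x (fun v => v m * speedCutoff L ‖v‖))) -
        3 * (rhoC r w x ^ 2 * thetaC r w x) := by
    rw [Finset.sum_sub_distrib, htr]
  rw [key, rhoC_mul_Mmom_sub_eq hr w x k l, pairFunctional_markT_eq_MpsiC hL]
  ring

/-- `Σ_kl a_kl ρ_r Σ^dev_kl = ρ_r Σ_kl (a_kl − (tr a/3)δ_kl) P_kl` with `P_kl = M(v_kv_l) − mₖmₗ/ρ_r` (the traceless part of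
`a` against the central second moments). [folklore] -/
theorem sum_mul_rhoC_mul_devC_eq {r : ℝ} (hr : 0 < r) (w : Phase N) (x : T3) (a : Fin 3 → Fin 3 → ℝ) :
    ∑ k : Fin 3, ∑ l : Fin 3, a k l * (rhoC r w x * devC r w x k l) =
      rhoC r w x * ∑ k : Fin 3, ∑ l : Fin 3, (a k l - (∑ j : Fin 3, a j j) / 3 * (if k = l then 1 else 0)) *
        (MpsiC r w x (fun v => v k * v l) - momC r w x k * momC r w x l / rhoC r w x) := by
  have hP : ∀ k l : Fin 3, MpsiC r w x (fun v => v k * v l) - momC r w x k * momC r w x l / rhoC r w x =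
      devC r w x k l + rhoC r w x * thetaC r w x * (if k = l then 1 else 0) := fun k l => by
    rw [← Mmom_eq_MpsiC]; exact ChaosClosesEulerReduction.Pm_eq_devC_add hr w x k l
  simp_rw [hP]
  have htr := devC_trace hr w x
  simp only [Fin.sum_univ_three, if_true, Fin.isValue] at htr ⊢
  have h01 : ((0 : Fin 3) = 1) = False := by decide
  have h02 : ((0 : Fin 3) = 2) = False := by decide
  have h10 : ((1 : Fin 3) = 0) = False := by decide
  have h12 : ((1 : Fin 3) = 2) = False := by decide
  have h20 : ((2 : Fin 3) = 0) = False := by decide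
  have h21 : ((2 : Fin 3) = 1) = False := by decide
  simp only [h01, h02, h10, h12, h20, h21, if_false, mul_zero, add_zero, sub_zero, mul_one]
  have e : devC r w x 2 2 = -(devC r w x 0 0 + devC r w x 1 1) := by linarith
  rw [e]; ring

end Defect

/-! ## §4 Registered sub-goal -/

/-- **Registered sub-goal `stub_pressureValueF` (helper F of `stub_pressureValueOfEnskog`)**: `ρ_r M_{kl} − mₖmₗ =
ρ_r Σ^dev_{kl} + ρ_r²θ_r δ_{kl}`. [folklore] -/
theorem stub_pressureValueF : ∀ {N : ℕ} {r : ℝ}, 0 < r → ∀ (w : Config (N + 1) (Fin 3) T3) (x : T3) (k l : Fin 3), rhoC r w x * Mmom r w x k l - momC r w x k * momC r w x l = rhoC r w x * devC r w x k l + rhoC r w x ^ 2 * thetaC r w x * (if k = l then 1 else 0) :=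
  fun hr w x k l => rhoC_mul_Mmom_sub_eq hr w x k l

end Summit.AtomisticToContinuum.HydrodynamicLimit.Theorems.ChaosClosesEulerPressureValue

end
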